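import Mathlib
import HarnessLib

/-!
# Enflo 2023, v2 p.16: `εθ`-linear independence and the lower bound (34) — as printed, and repaired

Source under adjudication: Per H. Enflo, *On the invariant subspace problem in Hilbert spaces*, arXiv:2305.15442 (v1
2023, v2 2024), bib key `Enflo2023` — a CLAIMED proof of the invariant subspace problem for operators on a separable
Hilbert space.  This file is part of the kernel-tight typing of the manuscript by the b2b-enflo repair cell
(formaliser 2, Part B: (28)–(47), the limiting argument and the final deduction).  It records what FOLLOWS (proved
implications from the manuscript's displayed hypotheses) and, where a step does not follow, the typed inference
together with its refutation.  NOTHING here asserts that the manuscript's main theorem holds; no declaration concludes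
the invariant subspace problem for an arbitrary operator.  Value (BLOCK-2b): theorems / refutations of typed
inferences about a text — not progress on the problem.

v2 p.16 (LaTeX l.538–551).  DEFINITION (typed as `SIndependent`): a finite family `z₁, …, z_m` is `s`-linearly
independent if `‖Σ aᵢ zᵢ‖ ≥ s · maxᵢ |aᵢ|` for all coefficients `a` (the paper lets `s = s(εθ) > 0` depend on `εθ`;
here `s` is a parameter).  CLAIM (34): "the size of the integrals in (28″)–(30″) are bounded from below by
`(Σ_j |r_j|) ×` (some fixed positive function of `εθ`)".  Each of those integrals is a LINEAR functional of the step
coefficients `r = (r_j)`; a single linear functional on a coefficient space of dimension ≥ 2 has a kernel, so (34)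
cannot hold AS PRINTED (`eq34_as_printed_false`).  What the argument uses, and what `s`-independence of the three
representing vectors does give (REPAIRED (34), `SIndependent.exists_inner_eq`): the JOINT map
`r ↦ (⟨z₁, r⟩, ⟨z₂, r⟩, ⟨z₃, r⟩)` is onto, with a preimage of norm `≤ (Σᵢ |tᵢ|)/s` for every target `t` — i.e. the three
first-order changes (28)–(30) can be prescribed at cost `1/s(εθ)`.  Proof: the Gram matrix of an `s`-independent family
is invertible (Mathlib `Matrix.det_gram_ne_zero_iff_linearIndependent`); take `r = Σ cⱼ zⱼ` with `Gram · c = t`; then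
`‖r‖² = Re Σ c̄ᵢ tᵢ ≤ maxᵢ|cᵢ| · Σ|tᵢ| ≤ (‖r‖/s) Σ|tᵢ|`.  Dictionary: paper `⟨u, w⟩` (linear in `u`) = Mathlib `⟪w, u⟫_ℂ`.
-/

open scoped InnerProductSpace ComplexConjugate
open RCLike Matrix Finset

namespace Literature.Analysis.OperatorTheory.Enflo2023

variable {H : Type*} [NormedAddCommGroup H] [InnerProductSpace ℂ H]
variable {ι : Type*} [Fintype ι]

/-- v2 p.16: the family `z` is `s`-linearly independent — `‖Σ aⱼ zⱼ‖ ≥ s · |aᵢ|` for every coefficient vector `a`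
and every index `i` (equivalently `≥ s · maxᵢ |aᵢ|`). [cite: Enflo2023, v2 p.16] -/
def SIndependent (s : ℝ) (z : ι → H) : Prop :=
  ∀ (a : ι → ℂ) (i : ι), s * ‖a i‖ ≤ ‖∑ j, a j • z j‖

omit [Fintype ι] in
/-- (34) AS PRINTED cannot hold: a single linear functional `L` of the step coefficients (here any linear map out of
a coefficient space of dimension ≥ 2, e.g. `Fin 2 → ℂ`) is never bounded below by `φ · Σ|rⱼ|` with `φ > 0`, because
it has a non-trivial kernel. [cite: Enflo2023, v2 (34), p.16] -/
theorem eq34_as_printed_false (L : (Fin 2 → ℂ) →ₗ[ℂ] ℂ) (φ : ℝ) (hφ : 0 < φ) :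
    ¬ ∀ r : Fin 2 → ℂ, φ * ∑ j, ‖r j‖ ≤ ‖L r‖ := by
  intro h
  have hker : LinearMap.ker L ≠ ⊥ :=
    LinearMap.ker_ne_bot_of_finrank_lt (by simp)
  obtain ⟨r, hrL, hr0⟩ := Submodule.exists_mem_ne_zero_of_ne_bot hker
  have hLr : L r = 0 := hrL
  obtain ⟨j, hj⟩ : ∃ j, r j ≠ 0 := by
    by_contra hcon
    push Not at hcon
    exact hr0 (funext hcon)
  have hpos : 0 < ∑ j, ‖r j‖ :=
    lt_of_lt_of_le (norm_pos_iff.mpr hj) (single_le_sum (fun i _ => norm_nonneg (r i)) (mem_univ j))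
  have := h r
  rw [hLr, norm_zero] at this
  nlinarith

/-- An `s`-independent family with `s > 0` is linearly independent. [folklore] -/
theorem SIndependent.linearIndependent {s : ℝ} {z : ι → H} (hs : 0 < s) (h : SIndependent s z) :
    LinearIndependent ℂ z := by
  rw [Fintype.linearIndependent_iff]
  intro a ha i
  have h1 := h a i
  rw [ha, norm_zero] at h1
  have h2 : ‖a i‖ ≤ 0 := by nlinarith [norm_nonneg (a i)]
  exact norm_le_zero_iff.mp h2

/-- (34) REPAIRED: if `z₁, …, z_m` are `s`-independent (`s > 0`), then for every target `t` there is a vector `r` in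
their span with `⟨zᵢ, r⟩ = tᵢ` for all `i` and `‖r‖ ≤ (Σᵢ |tᵢ|)/s` — the first-order changes (28)–(30) can be prescribed
jointly, at cost `1/s`. [cite: Enflo2023, v2 (34)–(37), p.16] -/
theorem SIndependent.exists_inner_eq [DecidableEq ι] {s : ℝ} {z : ι → H} (hs : 0 < s) (h : SIndependent s z)
    (t : ι → ℂ) :
    ∃ r : H, r ∈ Submodule.span ℂ (Set.range z) ∧ (∀ i, ⟪z i, r⟫_ℂ = t i) ∧ ‖r‖ ≤ (∑ i, ‖t i‖) / s := by
  have hli := h.linearIndependent hs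
  set G : Matrix ι ι ℂ := gram ℂ z with hG
  have hdet : IsUnit G.det := isUnit_iff_ne_zero.mpr (det_gram_ne_zero_iff_linearIndependent.mpr hli)
  set c : ι → ℂ := G⁻¹ *ᵥ t with hc
  have hGc : G *ᵥ c = t := by
    rw [hc, mulVec_mulVec, mul_nonsing_inv _ hdet, one_mulVec]
  set r : H := ∑ j, c j • z j with hr
  -- the pairings
  have hinner : ∀ i, ⟪z i, r⟫_ℂ = t i := by
    intro i
    rw [← hGc, hr, inner_sum]
    simp only [inner_smul_right, mulVec, dotProduct, gram_apply, G]
    exact sum_congr rfl fun j _ => mul_comm _ _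
  refine ⟨r, ?_, hinner, ?_⟩
  · exact Submodule.sum_mem _ fun j _ => Submodule.smul_mem _ _ (Submodule.subset_span ⟨j, rfl⟩)
  · -- ‖r‖² = Re ⟪r, r⟫ = Re (star c ⬝ᵥ t) ≤ Σ |cᵢ| |tᵢ| ≤ (‖r‖/s) Σ |tᵢ|
    have hci : ∀ i, ‖c i‖ ≤ ‖r‖ / s := by
      intro i
      rw [le_div_iff₀ hs, mul_comm]
      exact h c i
    have hsq : ‖r‖ ^ 2 = re (∑ i, conj (c i) * t i) := by
      have h1 : (⟪r, r⟫_ℂ) = ∑ i, conj (c i) * t i := by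
        have h2 := star_dotProduct_gram_mulVec (𝕜 := ℂ) z c c
        rw [← hG, hGc] at h2
        rw [hr, ← h2]
        simp [dotProduct]
      rw [← h1, inner_self_eq_norm_sq_to_K]; norm_cast
    have hle : ‖r‖ ^ 2 ≤ (‖r‖ / s) * ∑ i, ‖t i‖ := by
      rw [hsq, map_sum, mul_sum]
      refine sum_le_sum fun i _ => ?_
      calc re (conj (c i) * t i) ≤ ‖conj (c i) * t i‖ := re_le_norm _
        _ = ‖c i‖ * ‖t i‖ := by rw [norm_mul, RCLike.norm_conj]
        _ ≤ ‖r‖ / s * ‖t i‖ := mul_le_mul_of_nonneg_right (hci i) (norm_nonneg _)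
    by_cases hr0 : ‖r‖ = 0
    · rw [hr0]; positivity
    · have hrpos : 0 < ‖r‖ := lt_of_le_of_ne (norm_nonneg _) (Ne.symm hr0)
      rw [le_div_iff₀ hs]
      have : ‖r‖ * ‖r‖ ≤ ‖r‖ * ((∑ i, ‖t i‖) / s) := by
        calc ‖r‖ * ‖r‖ = ‖r‖ ^ 2 := (sq _).symm
          _ ≤ (‖r‖ / s) * ∑ i, ‖t i‖ := hle
          _ = ‖r‖ * ((∑ i, ‖t i‖) / s) := by ring
      have h3 := le_of_mul_le_mul_left this hrpos
      rw [le_div_iff₀ hs] at h3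
      exact h3

end Literature.Analysis.OperatorTheory.Enflo2023
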